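import Summits.BirchSwinnertonDyer.Rank1Residual.AdditivePotMult.ClassX3MPrimes
import Summits.BirchSwinnertonDyer.Rank1Residual.AdditivePotMult.TwistSupplyJClass
import Literature.NumberTheory.EllipticCurves.NonEisensteinPrimeOfSurjective
import Literature.NumberTheory.EllipticCurves.KramerTwoDescentValuation
import Literature.NumberTheory.EllipticCurves.ModEllNonSurjectiveDenominators
import HarnessLib

/-!
# X3♯(M) lives at `p ∈ {3, 5, 7, 13}` (Zywina's denominator criteria + the thirteen CM `j`'s)

HONEST FRAMING (cell `b2b-bsdres`, run/shared/lean/b2b/bsd-rank1-residual/, verbatim in every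
file): the goal of the cell is to DELETE the COMBINATION-SHAPED residual classes of the
Birch–Swinnerton-Dyer formula for ALL analytic-rank `≤ 1` elliptic curves over `ℚ` — "full BSD
formula for every rank `≤ 1` curve in class `C`" assembled STRICTLY from published theorems — so
that the rank-`≤ 1` remainder becomes exactly the CONSTRUCTION-SHAPED classes, which are TYPED
(missing-input `Prop`s), NOT attempted. This is not "finishing BSD". Sub-cell `additive-p1`,
generation 14: research route; theorems only on the Summits side; X3♯(M) stays CONSTRUCTION-SHAPED;
no label moves; nothing booked. Two PUBLISHED statements enter as named-fact HYPOTHESES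
(`hZ`, `hZ11`: Zywina, *Bull. LMS* 54 (2022) = arXiv:1508.07661, Thm. 1.5 and Prop. 6.1 (ℓ = 11,
third item), typed verbatim in `Literature/NumberTheory/EllipticCurves/ModEllNonSurjectiveDenominators.lean`);
Mazur 1978 Thm. 1 as before (`hM`); the thirteen CM `j`-invariants are the tree's THEOREM
`WeierstrassCurve.hasCM_iff_j_mem_holds` (via `PotMult.not_hasCM`, `TwistSupplyJClass.lean` §8).

WHAT THIS FILE DOES. `ClassX3MPrimes.lean` (p252827) placed the reducible potentially multiplicative
cell `ClassX3M W p` (`E[p]` reducible, `p² ∣ N`, `ord_p j(E) < 0`, `p ≠ 2`) at the eleven odd Mazur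
primes and left `-- TODO(general form): p ∈ {3, 5, 7, 13}`. The refinement needs no `j`-table of
`X₀(p)(ℚ)`: `ord_p j(E) < 0` means `p` divides the DENOMINATOR of `j(E)`, and Zywina's denominator
criteria say that for a non-CM `E` with NON-surjective `ρ̄_{E,ℓ}` — in particular a reducible one —
every prime of the denominator of `j(E)` is `≡ ±1 (mod ℓ)`, for `ℓ > 13` off the four exceptional
pairs `S₀` (Thm. 1.5) and for `ℓ = 11` (Prop. 6.1); `p ≡ 0 ≢ ±1 (mod p)`. The four exceptional
`j`-invariants of `S₀` are `17`- resp. `37`-integral, and a CM curve has one of the thirteen INTEGER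
`j`-invariants (`PotMult.not_hasCM`, `TwistSupplyJClass.lean` §8), so neither can be potentially
multiplicative at `p`. Hence
`ClassX3M W p → p ∈ {3, 5, 7, 13}` (`ClassX3M.prime_cases_sharp`, `ClassX3M.mem_primes_sharp`),
matching the census header of RESIDUAL-MAP §E ("X3 ∩ pot-mult: 3, 5, 7, (13 …)").

References: [Zywina2022Surjectivity] Thm. 1.5, Prop. 6.1; [Mazur1978] Thm. 1;
[SilvermanAEC2009] App. C §11 (tree theorem `hasCM_iff_j_mem_holds`).
-/

noncomputable section

open scoped Classical

open WeierstrassCurve Literature.NumberTheory.EllipticCurves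
  Literature.NumberTheory.EllipticCurves.Rank1Residual

namespace Summit.BirchSwinnertonDyer.Rank1Residual.AdditivePotMult

/-! ## Arithmetic of `ord_p` on explicit rationals -/

variable {W : WeierstrassCurve ℚ} [W.IsElliptic] [W.IsGloballyMinimal] {p : ℕ} [hp : Fact p.Prime]

omit hp in
/-- `ord_p q < 0` forces `p ∣ den q`. [folklore] -/
theorem dvd_den_of_padicValRat_neg {q : ℚ} (h : padicValRat p q < 0) : p ∣ q.den := by
  rw [padicValRat_def] at h
  have h0 : (0 : ℤ) ≤ (padicValInt p q.num : ℤ) := Int.natCast_nonneg _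
  have h1 : 1 ≤ padicValNat p q.den := by omega
  exact dvd_of_one_le_padicValNat h1

/-- `ord_p (n / d) ≥ 0` for an integer `n ≠ 0` and a natural `d` prime to `p`. [folklore] -/
theorem padicValRat_div_nonneg_of_not_dvd {n : ℤ} {d : ℕ} (hn : n ≠ 0) (hd : d ≠ 0)
    (hpd : ¬ p ∣ d) : 0 ≤ padicValRat p ((n : ℚ) / (d : ℚ)) := by
  rw [padicValRat.div (by exact_mod_cast hn) (by exact_mod_cast hd), padicValRat.of_int,
    padicValRat.of_nat, padicValNat.eq_zero_of_not_dvd hpd]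
  simp

/-! ## The exceptional pairs are never potentially multiplicative

(CM curves neither: `PotMult.not_hasCM`, `TwistSupplyJClass.lean` §8 — the thirteen CM `j`'s are
integers, tree theorem `hasCM_iff_j_mem_holds`.) -/

omit [W.IsGloballyMinimal] in
/-- **The four exceptional pairs are not potentially multiplicative**: the `j`-invariants of `S₀` are
`17`- resp. `37`-integral (`−17²·101³/2`, `−17·373³/2¹⁷` have `2`-power denominators;
`−7·11³`, `−7·137³·2083³` are integers). [folklore] -/
theorem PotMult.not_mem_zywinaExceptionalPairs (hpm : PotMult W p) :
    (p, W.j) ∉ zywinaExceptionalPairs := by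
  intro hmem
  have hv : padicValRat p W.j < 0 := hpm.2
  simp only [zywinaExceptionalPairs, Finset.mem_insert, Finset.mem_singleton, Prod.mk.injEq] at hmem
  rcases hmem with ⟨hp17, hj⟩ | ⟨hp17, hj⟩ | ⟨hp37, hj⟩ | ⟨hp37, hj⟩
  · subst hp17
    have h := padicValRat_div_nonneg_of_not_dvd (p := 17) (n := -(17 ^ 2 * 101 ^ 3)) (d := 2)
      (by norm_num) (by norm_num) (by norm_num)
    have he : W.j = ((-(17 ^ 2 * 101 ^ 3) : ℤ) : ℚ) / ((2 : ℕ) : ℚ) := by rw [hj]; push_cast; ring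
    rw [← he] at h
    omega
  · subst hp17
    have h := padicValRat_div_nonneg_of_not_dvd (p := 17) (n := -(17 * 373 ^ 3)) (d := 2 ^ 17)
      (by norm_num) (by norm_num) (by norm_num)
    have he : W.j = ((-(17 * 373 ^ 3) : ℤ) : ℚ) / ((2 ^ 17 : ℕ) : ℚ) := by rw [hj]; push_cast; ring
    rw [← he] at h
    omega
  · subst hp37
    have h := KramerTwoDescent.padicValRat_intCast_nonneg (p := 37) (-(7 * 11 ^ 3))
    have he : W.j = ((-(7 * 11 ^ 3) : ℤ) : ℚ) := by rw [hj]; push_cast; ring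
    rw [← he] at h
    omega
  · subst hp37
    have h := KramerTwoDescent.padicValRat_intCast_nonneg (p := 37) (-(7 * 137 ^ 3 * 2083 ^ 3))
    have he : W.j = ((-(7 * 137 ^ 3 * 2083 ^ 3) : ℤ) : ℚ) := by rw [hj]; push_cast; ring
    rw [← he] at h
    omega

/-! ## The sharpened prime support -/

/-- `p ≢ ±1 (mod p)` for a prime `p`: the residue of `p` in `ZMod p` is `0`, which is neither `1`
nor `−1`. [folklore] -/
theorem natCast_self_ne_pm_one : ¬ ((p : ZMod p) = 1 ∨ (p : ZMod p) = -1) := by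
  haveI : Fact (1 < p) := ⟨hp.out.one_lt⟩
  rw [ZMod.natCast_self]
  rintro (h | h)
  · exact zero_ne_one h
  · exact zero_ne_one (neg_eq_zero.mp h.symm).symm

omit [W.IsGloballyMinimal] in
/-- **Reducible and potentially multiplicative at `p` is impossible at `p = 11` and at every prime
`p > 13`** (for ANY `E/ℚ`): `E` is non-CM (`PotMult.not_hasCM`), `ρ̄_{E,p}` is not surjective
(surjective ⇒ irreducible, tree theorem), `(p, j(E)) ∉ S₀` (`PotMult.not_mem_zywinaExceptionalPairs`),
and `p ∣ den j(E)` (`ord_p j(E) < 0`); Zywina's criteria then give `p ≡ ±1 (mod p)`, absurd.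
[cite: Zywina2022Surjectivity, Thm. 1.5 and Prop. 6.1] -/
theorem PotMult.not_red_of_eleven_or_gt (hZ : zywina_nonsurjective_denominators)
    (hZ11 : zywina_nonsurjective_denominators_eleven) (hpm : PotMult W p)
    (hp' : p = 11 ∨ 13 < p) : ¬ Red W p := by
  intro hred
  have hprime : p.Prime := hp.out
  have hCM : ¬ W.HasCM := hpm.not_hasCM
  have hden : p ∣ W.j.den := dvd_den_of_padicValRat_neg hpm.2
  have hsurj : ¬ W.HasSurjectiveModNGaloisRep p := by
    intro hs
    haveI : NeZero p := ⟨hprime.ne_zero⟩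
    exact hred (hasIrreducibleModPGaloisRep_of_hasSurjectiveModNGaloisRep W p hs)
  rcases hp' with h11 | h13
  · subst h11
    have hne : W.j.den ≠ 1 := by
      intro h1
      rw [h1] at hden
      exact absurd (Nat.le_of_dvd one_pos hden) (by norm_num)
    exact natCast_self_ne_pm_one (hZ11 W hCM hne hsurj 11 hprime hden).1
  · exact natCast_self_ne_pm_one
      (hZ W hCM p hprime h13 hpm.not_mem_zywinaExceptionalPairs hsurj p hprime hden).1

/-- **X3♯(M) lives at `p ∈ {3, 5, 7, 13}`**: an odd Mazur prime (`ClassX3M.prime_cases`, Mazur 1978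
Thm. 1) other than `11, 17, 19, 37, 43, 67, 163` (`PotMult.not_red_of_eleven_or_gt`, Zywina).
[cite: Zywina2022Surjectivity, Thm. 1.5 and Prop. 6.1] [cite: Mazur1978, Thm 1] -/
theorem ClassX3M.prime_cases_sharp (hM : mazur_isogeny_irreducible)
    (hZ : zywina_nonsurjective_denominators) (hZ11 : zywina_nonsurjective_denominators_eleven)
    (hX : ClassX3M W p) : p = 3 ∨ p = 5 ∨ p = 7 ∨ p = 13 := by
  have hcases := hX.prime_cases hM
  have hred : Red W p := hX.classX3.1
  have hnot : ¬ (p = 11 ∨ 13 < p) := fun h =>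
    PotMult.not_red_of_eleven_or_gt hZ hZ11 hX.potMult h hred
  omega

/-- **X3♯(M) lives at `p ∈ {3, 5, 7, 13}`**, `Finset` form. [cite: Zywina2022Surjectivity, Thm. 1.5
and Prop. 6.1] [cite: Mazur1978, Thm 1] -/
theorem ClassX3M.mem_primes_sharp (hM : mazur_isogeny_irreducible)
    (hZ : zywina_nonsurjective_denominators) (hZ11 : zywina_nonsurjective_denominators_eleven)
    (hX : ClassX3M W p) : p ∈ ({3, 5, 7, 13} : Finset ℕ) := by
  have h := hX.prime_cases_sharp hM hZ hZ11
  simp only [Finset.mem_insert, Finset.mem_singleton]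
  omega

/-- **X3♯(M): `p ≤ 13`.** [cite: Zywina2022Surjectivity, Thm. 1.5 and Prop. 6.1]
[cite: Mazur1978, Thm 1] -/
theorem ClassX3M.le_thirteen (hM : mazur_isogeny_irreducible)
    (hZ : zywina_nonsurjective_denominators) (hZ11 : zywina_nonsurjective_denominators_eleven)
    (hX : ClassX3M W p) : p ≤ 13 := by
  have h := hX.prime_cases_sharp hM hZ hZ11
  omega

/-! ## Appendix (gen 14, same session): Zywina ALONE — no Mazur — and surjectivity on (M)

Zywina's Thm. 1.5 covers EVERY prime `ℓ > 13` (not only the Mazur primes), so the prime support of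
X3♯(M) follows from `hZ`/`hZ11` without `mazur_isogeny_irreducible`; and since Thm. 1.5 / Prop. 6.1
speak of NON-SURJECTIVITY (not only reducibility), a potentially multiplicative `p` forces
`ρ̄_{E,p}` ONTO at `p = 11` and at every `p > 13` — a second printed source, next to
Balakrishnan–Dogra–Müller–Tuitman–Vonk 2019 (`ClassX4M.surj_of_eleven_le`, `p ≥ 11`), for the
image input of the `p ≥ 11` X4(M) statements, independent of it except at `p = 13`. -/

omit [W.IsGloballyMinimal] in
/-- **On the (M) locus `ρ̄_{E,p}` is surjective at `p = 11` and at every prime `p > 13`** (ANY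
`E/ℚ` with `ord_p j(E) < 0` and additive reduction at `p`): `E` is non-CM, `p ∣ den j(E)`,
`(p, j(E)) ∉ S₀`; were `ρ̄_{E,p}` not surjective, Zywina's criteria would give `p ≡ ±1 (mod p)`.
[cite: Zywina2022Surjectivity, Thm. 1.5 and Prop. 6.1] -/
theorem PotMult.surj_of_eleven_or_gt (hZ : zywina_nonsurjective_denominators)
    (hZ11 : zywina_nonsurjective_denominators_eleven) (hpm : PotMult W p)
    (hp' : p = 11 ∨ 13 < p) : Surj W p := by
  by_contra hsurj
  have hprime : p.Prime := hp.out
  have hCM : ¬ W.HasCM := hpm.not_hasCM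
  have hden : p ∣ W.j.den := dvd_den_of_padicValRat_neg hpm.2
  rcases hp' with h11 | h13
  · subst h11
    have hne : W.j.den ≠ 1 := by
      intro h1
      rw [h1] at hden
      exact absurd (Nat.le_of_dvd one_pos hden) (by norm_num)
    exact natCast_self_ne_pm_one (hZ11 W hCM hne hsurj 11 hprime hden).1
  · exact natCast_self_ne_pm_one
      (hZ W hCM p hprime h13 hpm.not_mem_zywinaExceptionalPairs hsurj p hprime hden).1

omit [W.IsGloballyMinimal] in
/-- **X4(M): `ρ̄_{E,p}` onto at `p = 11` and at every `p > 13`** by Zywina alone (cf.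
`ClassX4M.surj_of_eleven_le`, BDMTV 2019, which also covers `p = 13`).
[cite: Zywina2022Surjectivity, Thm. 1.5 and Prop. 6.1] -/
theorem ClassX4M.surj_of_eleven_or_gt_of_zywina (hZ : zywina_nonsurjective_denominators)
    (hZ11 : zywina_nonsurjective_denominators_eleven) (hX : ClassX4M W p)
    (hp' : p = 11 ∨ 13 < p) : Surj W p :=
  hX.potMult.surj_of_eleven_or_gt hZ hZ11 hp'

/-- **X3♯(M) prime support `{3, 5, 7, 13}` from Zywina ALONE** (no `mazur_isogeny_irreducible`):
`p` is a prime `≠ 2` (class), `≠ 11` and `≤ 13` (`PotMult.not_red_of_eleven_or_gt`).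
[cite: Zywina2022Surjectivity, Thm. 1.5 and Prop. 6.1] -/
theorem ClassX3M.prime_cases_of_zywina (hZ : zywina_nonsurjective_denominators)
    (hZ11 : zywina_nonsurjective_denominators_eleven) (hX : ClassX3M W p) :
    p = 3 ∨ p = 5 ∨ p = 7 ∨ p = 13 := by
  have hprime : p.Prime := hp.out
  have h2 : p ≠ 2 := hX.p_ne_two
  have hred : Red W p := hX.classX3.1
  have h11 : p ≠ 11 := fun h =>
    PotMult.not_red_of_eleven_or_gt hZ hZ11 hX.potMult (Or.inl h) hred
  have h13 : p ≤ 13 := by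
    by_contra h
    exact PotMult.not_red_of_eleven_or_gt hZ hZ11 hX.potMult (Or.inr (by omega)) hred
  interval_cases p <;> first | omega | (exfalso; norm_num at hprime)

/-- **X3♯(M) ⊆ {3, 5, 7, 13}, `Finset` form, Zywina alone.**
[cite: Zywina2022Surjectivity, Thm. 1.5 and Prop. 6.1] -/
theorem ClassX3M.mem_primes_of_zywina (hZ : zywina_nonsurjective_denominators)
    (hZ11 : zywina_nonsurjective_denominators_eleven) (hX : ClassX3M W p) :
    p ∈ ({3, 5, 7, 13} : Finset ℕ) := by
  have h := hX.prime_cases_of_zywina hZ hZ11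
  simp only [Finset.mem_insert, Finset.mem_singleton]
  omega

end Summit.BirchSwinnertonDyer.Rank1Residual.AdditivePotMult

end
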